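import Summits.Ventures.YMGap.RobustBall.RobustMassGapDoor
import HarnessLib

/-!
# Venture YMGap, track ROBUST-BALL — uniqueness and exponential clustering through the robust door

HONEST FRAMING. WHAT THIS IS: a venture file (cell `pub-ymgap`, track Y2 ROBUST-BALL, seat rb-p1): the
two CONCLUSIONS of the robust single-link Dobrushin door (`RobustMassGapDoor.lean`) for the perturbed
`SU(N)` lattice action `N β S_W + W` on `ℤ^d`, UNIFORM IN THE LOADS `(a, Λ, R)` of `W` and the one-link
pair `(c, v)`: whenever the row-sum bound
`ρ = 6(d-1)|β| e^{a} √(c v) + e^{a/2} √c Λ < 1`,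
(i) `𝒢(N β S_W + W)` has AT MOST ONE element (Dobrushin uniqueness, Vasserstein form), and
(ii) every DLR state clusters exponentially on Lipschitz cylinder observables in the Shen–Zhu–Zhu form
`|cov(F₁, F₂)| ≤ c₁ e^{-m d(Λ₁, Λ₂)} (K₁ K₂ + ‖F₁‖₂ ‖F₂‖₂)` with the EXPLICIT rate
`m = -log max(ρ, 1/2) / max(1, R)` (lattice units; `R` = the `ℓ^∞` range of `W`).
WHAT THIS IS NOT: existence of the DLR state is NOT proved here (`PerturbedExistence.lean`; with it (i)
becomes `HasUniqueGibbsMeasure`); no number; strong-coupling LATTICE statement only — `ρ < 1` is where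
a bound closes, not a physical transition; no continuum, no Millennium claim.

## References

* R. L. Dobrushin 1970, Thm. 4; H. Föllmer, LNM 1362 (1988) Ch. I (2.9), Thm. (2.13), Rem. (2.17).
* H. Shen, R. Zhu, X. Zhu, CMP 400 (2023) 805, Cor. 1.6 (the clustering currency `MassGapAt`).
* The tree: `shen_zhu_zhu_of_dobrushinCondition` (`LatticeGaugeDobrushin.lean`), whose part (ii) this
  file re-runs with the range `R₀ = max(1, R)` of the perturbed one-link law in place of `1`.
-/

noncomputable section

open MeasureTheory Filter Function ProbabilityTheory Real
open scoped NNReal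
open Literature.Probability.LatticeModels
open Literature.Probability.LatticeModels.DobrushinMetric
open Literature.MathematicalPhysics.QuantumLattice
open Literature.MathematicalPhysics.QuantumFieldTheory hiding ZdEdge

namespace Summit.Ventures.YMGap.RobustBall

variable {d N : ℕ}

/-- **(i) DLR UNIQUENESS on the ball, single-link door.** Under the hypotheses of
`isKRContraction_perturbedYM_SU` (one-link pair `(c, v)` on the ball `b ≥ 2(d-1)|β|`; adapted `W`
with bounded terms, supported by `supp`, with per-link oscillation witnesses `osc` of load `a` and Lipschitz witnesses `lip` of cross load `Λ`) and the
smallness `ρ = 6(d-1)|β| e^{a}√(c v) + e^{a/2}√c Λ < 1`, the perturbed `SU(N)` specification at bare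
coupling `N β` has at most one Gibbs measure (Dobrushin 1970 / Föllmer 1988 (2.9), via the tree's
`subsingleton_gibbsMeasures_of_isKRContraction` with the Frobenius weight, `R = 2√N`, `A = 1`). -/
theorem subsingleton_perturbedGibbsMeasures_SU (hd : 1 ≤ d) (hN : 1 ≤ N) {β b c v a Λ : ℝ}
    (hc : 0 ≤ c) (hv : 0 ≤ v) (hb : |β| * (2 * ((d : ℝ) - 1)) ≤ b)
    (hP : ∀ B : Matrix (Fin N) (Fin N) ℂ, matrixOpNorm B ≤ b →
      ∀ (ψ : Matrix.specialUnitaryGroup (Fin N) ℂ → ℝ) (M : ℝ), 0 ≤ M →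
        (∀ x y, |ψ x - ψ y| ≤ M * suFrobDist x y) →
        Var[ψ; (haarProbability (Matrix.specialUnitaryGroup (Fin N) ℂ)).tilted
          fun g => (N : ℝ) * ((g : Matrix (Fin N) (Fin N) ℂ) * B).trace.re] ≤ c * M ^ 2)
    (hVB : ∀ B : Matrix (Fin N) (Fin N) ℂ, matrixOpNorm B ≤ b → ∀ Δ : Matrix (Fin N) (Fin N) ℂ,
      Var[fun g : Matrix.specialUnitaryGroup (Fin N) ℂ =>
          (N : ℝ) * ((g : Matrix (Fin N) (Fin N) ℂ) * Δ).trace.re;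
        (haarProbability (Matrix.specialUnitaryGroup (Fin N) ℂ)).tilted
          fun g => (N : ℝ) * ((g : Matrix (Fin N) (Fin N) ℂ) * B).trace.re] ≤ v * frobNorm Δ ^ 2)
    {W : Potential (ZdEdge d) (Matrix.specialUnitaryGroup (Fin N) ℂ)} (hW : W.IsAdapted)
    (hWb : ∀ X, ∃ C, ∀ U, |W X U| ≤ C)
    {supp : Finset (ZdEdge d) → Finset (Finset (ZdEdge d))} (hsupp : W.IsSupportedBy supp)
    {osc : Finset (ZdEdge d) → ZdEdge d → ℝ} (hosc : ∀ X, Dobrushin.IsOscBound (W X) (osc X))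
    (hosca : ∀ e, ∑ X ∈ (supp {e}).filter (fun X => e ∈ X), osc X e ≤ a)
    {lip : Finset (ZdEdge d) → ZdEdge d → ℝ} (hlip : ∀ X, IsLipBound suFrobDist (W X) (lip X))
    (hΛ : ∀ e, ∑ y ∈ perturbedNbr supp e, ∑ X ∈ (supp {e}).filter (fun X => e ∈ X), lip X y ≤ Λ)
    (hρ : 6 * ((d : ℝ) - 1) * |β| * (exp a * Real.sqrt (c * v)) + exp (a / 2) * Real.sqrt c * Λ < 1) :
    (perturbedGibbsMeasures (d := d) (fundamentalRep (Fin N)) (N * β) W supp).Subsingleton := by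
  classical
  haveI : SecondCountableTopology (Matrix (Fin N) (Fin N) ℂ) :=
    inferInstanceAs (SecondCountableTopology (Fin N → Fin N → ℂ))
  haveI : SecondCountableTopology (Matrix.specialUnitaryGroup (Fin N) ℂ) :=
    Topology.IsEmbedding.subtypeVal.secondCountableTopology
  have hγ : IsSpecification (perturbedYM (d := d) (fundamentalRep (Fin N)) (N * β) W supp) :=
    isSpecification_perturbedYM _ (continuous_fundamentalRep (Fin N)) _ hW hWb hsupp
  have hKR := isKRContraction_perturbedYM_SU hd hN hc hv hb hP hVB hW (supp := supp) hosc hosca hlip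
  have hrow := sum_perturbedNbr_coeff_le hd (β := β) (c := c) (v := v) (a := a) hΛ
  have hρ0 : 0 ≤ 6 * ((d : ℝ) - 1) * |β| * (exp a * Real.sqrt (c * v)) + exp (a / 2) * Real.sqrt c * Λ := by
    have hd' : (1 : ℝ) ≤ d := by exact_mod_cast hd
    have hΛ0 : 0 ≤ Λ := by
      have hd0 : 0 < d := hd
      let e₀ : ZdEdge d := (0, ⟨0, hd0⟩)
      exact (Finset.sum_nonneg fun y _ => Finset.sum_nonneg fun X _ => (hlip X).nonneg y).trans (hΛ e₀)
    have : 0 ≤ (d : ℝ) - 1 := by linarith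
    positivity
  exact subsingleton_gibbsMeasures_of_isKRContraction hγ hKR (fun _ _ => suFrobDist_nonneg _ _)
    suFrobDist_le suEntries measurableSpace_specialUnitaryGroup_eq_comap zero_le_one
    (fun a b => by rw [one_mul]; exact dist_suEntries_le_suFrobDist a b) hρ0 hρ hrow

/-- **(ii) EXPONENTIAL CLUSTERING on the ball, single-link door, explicit rate.** Under the hypotheses
of `subsingleton_perturbedGibbsMeasures_SU` and the range bound `‖e - y‖_∞ ≤ R` for the links `y` of
the listed sets through `e`, every DLR state `μ` of the perturbed `SU(N)` theory at bare coupling `N β`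
satisfies, for every support bound `n`, with ONE constant `c₁ = 2 (2√N)² n² e^{κ}`,
`|cov_μ(F₁, F₂)| ≤ c₁ e^{-(κ/R₀) d(Λ₁, Λ₂)} (K₁ K₂ + ‖F₁‖₂ ‖F₂‖₂)` for Lipschitz cylinder functions `Fᵢ`
with supports `|Λᵢ| ≤ n` — `κ = -log max(ρ, 1/2) > 0`, `R₀ = max(1, R)` (Föllmer 1988 Thm. (2.13) via
the tree's `abs_covariance_le_of_isKRContraction` with the profile `⌊dist(·, Λ₂)/R₀⌋`; the body of the
cell's `MassGapAt` (ii) for the member). -/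
theorem perturbed_covariance_decay_SU (hd : 1 ≤ d) (hN : 1 ≤ N) {β b c v a Λ R : ℝ}
    (hc : 0 ≤ c) (hv : 0 ≤ v) (hb : |β| * (2 * ((d : ℝ) - 1)) ≤ b)
    (hP : ∀ B : Matrix (Fin N) (Fin N) ℂ, matrixOpNorm B ≤ b →
      ∀ (ψ : Matrix.specialUnitaryGroup (Fin N) ℂ → ℝ) (M : ℝ), 0 ≤ M →
        (∀ x y, |ψ x - ψ y| ≤ M * suFrobDist x y) →
        Var[ψ; (haarProbability (Matrix.specialUnitaryGroup (Fin N) ℂ)).tilted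
          fun g => (N : ℝ) * ((g : Matrix (Fin N) (Fin N) ℂ) * B).trace.re] ≤ c * M ^ 2)
    (hVB : ∀ B : Matrix (Fin N) (Fin N) ℂ, matrixOpNorm B ≤ b → ∀ Δ : Matrix (Fin N) (Fin N) ℂ,
      Var[fun g : Matrix.specialUnitaryGroup (Fin N) ℂ =>
          (N : ℝ) * ((g : Matrix (Fin N) (Fin N) ℂ) * Δ).trace.re;
        (haarProbability (Matrix.specialUnitaryGroup (Fin N) ℂ)).tilted
          fun g => (N : ℝ) * ((g : Matrix (Fin N) (Fin N) ℂ) * B).trace.re] ≤ v * frobNorm Δ ^ 2)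
    {W : Potential (ZdEdge d) (Matrix.specialUnitaryGroup (Fin N) ℂ)} (hW : W.IsAdapted)
    (hWb : ∀ X, ∃ C, ∀ U, |W X U| ≤ C)
    {supp : Finset (ZdEdge d) → Finset (Finset (ZdEdge d))} (hsupp : W.IsSupportedBy supp)
    {osc : Finset (ZdEdge d) → ZdEdge d → ℝ} (hosc : ∀ X, Dobrushin.IsOscBound (W X) (osc X))
    (hosca : ∀ e, ∑ X ∈ (supp {e}).filter (fun X => e ∈ X), osc X e ≤ a)
    {lip : Finset (ZdEdge d) → ZdEdge d → ℝ} (hlip : ∀ X, IsLipBound suFrobDist (W X) (lip X))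
    (hΛ : ∀ e, ∑ y ∈ perturbedNbr supp e, ∑ X ∈ (supp {e}).filter (fun X => e ∈ X), lip X y ≤ Λ)
    (hR : ∀ e, ∀ X ∈ supp {e}, e ∈ X → ∀ y ∈ X, ‖e.1 - y.1‖ ≤ R)
    (hρ : 6 * ((d : ℝ) - 1) * |β| * (exp a * Real.sqrt (c * v)) + exp (a / 2) * Real.sqrt c * Λ < 1)
    (μ : Measure (LGConfig d (Matrix.specialUnitaryGroup (Fin N) ℂ)))
    (hμ : μ ∈ perturbedGibbsMeasures (d := d) (fundamentalRep (Fin N)) (N * β) W supp) (n : ℕ) :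
    ∀ (F₁ F₂ : LGConfig d (Matrix.specialUnitaryGroup (Fin N) ℂ) → ℝ) (Λ₁ Λ₂ : Finset (ZdEdge d))
      (K₁ K₂ : ℝ≥0), Λ₁.card ≤ n → Λ₂.card ≤ n → Disjoint Λ₁ Λ₂ →
      IsLipschitzCylinder (fundamentalRep (Fin N)) F₁ Λ₁ K₁ →
      IsLipschitzCylinder (fundamentalRep (Fin N)) F₂ Λ₂ K₂ →
        |cov[F₁, F₂; μ]| ≤
          (2 * (2 * Real.sqrt N) ^ 2 * (n : ℝ) ^ 2 *
              exp (-Real.log (max (6 * ((d : ℝ) - 1) * |β| * (exp a * Real.sqrt (c * v)) +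
                exp (a / 2) * Real.sqrt c * Λ) (1 / 2)))) *
            exp (-(-Real.log (max (6 * ((d : ℝ) - 1) * |β| * (exp a * Real.sqrt (c * v)) +
                exp (a / 2) * Real.sqrt c * Λ) (1 / 2)) / max 1 R) * setDistEdges Λ₁ Λ₂) *
            ((K₁ : ℝ) * K₂ + Real.sqrt (∫ U, F₁ U ^ 2 ∂μ) * Real.sqrt (∫ U, F₂ U ^ 2 ∂μ)) := by
  classical
  intro F₁ F₂ Λ₁ Λ₂ K₁ K₂ h₁ h₂ _ hF₁ hF₂
  haveI : SecondCountableTopology (Matrix (Fin N) (Fin N) ℂ) :=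
    inferInstanceAs (SecondCountableTopology (Fin N → Fin N → ℂ))
  haveI : SecondCountableTopology (Matrix.specialUnitaryGroup (Fin N) ℂ) :=
    Topology.IsEmbedding.subtypeVal.secondCountableTopology
  have hγ : IsSpecification (perturbedYM (d := d) (fundamentalRep (Fin N)) (N * β) W supp) :=
    isSpecification_perturbedYM _ (continuous_fundamentalRep (Fin N)) _ hW hWb hsupp
  have hKR := isKRContraction_perturbedYM_SU hd hN hc hv hb hP hVB hW (supp := supp) hosc hosca hlip
  have hrow := sum_perturbedNbr_coeff_le hd (β := β) (c := c) (v := v) (a := a) hΛ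
  set ρ : ℝ := 6 * ((d : ℝ) - 1) * |β| * (exp a * Real.sqrt (c * v)) + exp (a / 2) * Real.sqrt c * Λ with hρdef
  -- constants
  set c' : ℝ := max ρ (1 / 2) with hc'
  have hc'0 : 0 < c' := lt_max_of_lt_right (by norm_num)
  have hc'1 : c' < 1 := max_lt hρ (by norm_num)
  have hrow' : ∀ x, ∑ y ∈ perturbedNbr supp x,
      (exp a * Real.sqrt (c * v) * |β| * linkInfluence x y +
        exp (a / 2) * Real.sqrt c * ∑ X ∈ (supp {x}).filter (fun X => x ∈ X), lip X y) ≤ c' :=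
    fun x => (hrow x).trans (le_max_left _ _)
  set κ : ℝ := -Real.log c' with hκ
  have hκ0 : 0 < κ := neg_pos.2 (Real.log_neg hc'0 hc'1)
  set R₀ : ℝ := max 1 R with hR₀
  have hR₀1 : 1 ≤ R₀ := le_max_left _ _
  have hR₀0 : 0 < R₀ := zero_lt_one.trans_le hR₀1
  have hRsqrt : (0 : ℝ) ≤ 2 * Real.sqrt N := by positivity
  have hμ' : IsGibbsMeasure (perturbedYM (d := d) (fundamentalRep (Fin N)) (N * β) W supp) μ := hμ
  haveI := hμ'.isProbabilityMeasure
  -- distances within the range of the one-link law are at most `R₀`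
  have hnbr : ∀ x, ∀ y ∈ perturbedNbr supp x, ‖x.1 - y.1‖ ≤ R₀ := by
    intro x y hy
    rcases (mem_perturbedNbr_iff.1 hy).2 with hy' | ⟨X, hX, hxX, hyX⟩
    · exact (norm_sub_le_one_of_mem_linkPlaqNbr hy').trans hR₀1
    · exact (hR x X hX hxX y hyX).trans (le_max_right _ _)
  -- the profile `ℓ = ⌊dist(·, Λ₂)/R₀⌋`
  set ℓ : ZdEdge d → ℕ := fun y => ⌊linkSetDist Λ₂ y / R₀⌋₊ with hℓ
  have hℓ0 : ∀ y ∈ Λ₂, ℓ y = 0 := fun y hy => by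
    simp [hℓ, linkSetDist_eq_zero_of_mem hy]
  have hℓ1 : ∀ x ∉ Λ₂, ∀ y ∈ perturbedNbr supp x, ℓ x ≤ ℓ y + 1 := fun x _ y hy => by
    have h1 : linkSetDist Λ₂ x / R₀ ≤ linkSetDist Λ₂ y / R₀ + 1 := by
      rw [div_add_one hR₀0.ne', div_le_div_iff_of_pos_right hR₀0]
      exact (linkSetDist_le_add_norm Λ₂ x y).trans (add_le_add_right (hnbr x y hy) _)
    calc ℓ x ≤ ⌊linkSetDist Λ₂ y / R₀ + 1⌋₊ := Nat.floor_mono h1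
      _ = ℓ y + 1 := Nat.floor_add_one (div_nonneg (linkSetDist_nonneg _ _) hR₀0.le)
  -- the covariance estimate of the Dobrushin regime
  have key := abs_covariance_le_of_isKRContraction hγ hKR (fun _ _ => suFrobDist_nonneg _ _)
    suFrobDist_le hRsqrt hc'0.le hc'1.le hrow' hμ'
    hF₁.measurable hF₁.dependsOn hF₁.abs_le
    (hF₁.isLipBound zero_le_one (fun a b => by rw [one_mul]; exact dist_suEntries_le_suFrobDist a b))
    hF₂.measurable hF₂.dependsOn hF₂.abs_le
    (hF₂.isLipBound zero_le_one (fun a b => by rw [one_mul]; exact dist_suEntries_le_suFrobDist a b))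
    ℓ hℓ0 hℓ1
  have hK₁ : (0 : ℝ) ≤ K₁ := K₁.2
  have hK₂ : (0 : ℝ) ≤ K₂ := K₂.2
  have hn₁ : (Λ₁.card : ℝ) ≤ n := by exact_mod_cast h₁
  have hn₂ : (Λ₂.card : ℝ) ≤ n := by exact_mod_cast h₂
  -- the two sums
  have hsum₂ : ∑ y ∈ Λ₂, (if y ∈ Λ₂ then 1 * (K₂ : ℝ) else 0) ≤ n * K₂ := by
    rw [Finset.sum_ite_of_true (fun y hy => hy), Finset.sum_const, nsmul_eq_mul, one_mul]
    exact mul_le_mul_of_nonneg_right hn₂ hK₂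
  have hm : ∀ y ∈ Λ₁, ⌊setDistEdges Λ₁ Λ₂ / R₀⌋₊ ≤ ℓ y := fun y hy =>
    Nat.floor_mono (div_le_div_of_nonneg_right (setDistEdges_le_linkSetDist hy) hR₀0.le)
  have hsum₁ : ∑ y ∈ Λ₁, c' ^ ℓ y * (if y ∈ Λ₁ then 1 * (K₁ : ℝ) else 0) ≤
      n * (c' ^ ⌊setDistEdges Λ₁ Λ₂ / R₀⌋₊ * K₁) := by
    calc ∑ y ∈ Λ₁, c' ^ ℓ y * (if y ∈ Λ₁ then 1 * (K₁ : ℝ) else 0)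
        ≤ ∑ y ∈ Λ₁, c' ^ ⌊setDistEdges Λ₁ Λ₂ / R₀⌋₊ * K₁ := Finset.sum_le_sum fun y hy => by
          rw [if_pos hy, one_mul]
          exact mul_le_mul_of_nonneg_right (pow_le_pow_of_le_one hc'0.le hc'1.le (hm y hy)) hK₁
      _ = Λ₁.card * (c' ^ ⌊setDistEdges Λ₁ Λ₂ / R₀⌋₊ * K₁) := by rw [Finset.sum_const, nsmul_eq_mul]
      _ ≤ n * (c' ^ ⌊setDistEdges Λ₁ Λ₂ / R₀⌋₊ * K₁) :=
          mul_le_mul_of_nonneg_right hn₁ (by positivity)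
  -- the geometric factor `c'^{⌊D/R₀⌋} ≤ e^{κ} e^{-(κ/R₀) D}`
  have hgeom : c' ^ ⌊setDistEdges Λ₁ Λ₂ / R₀⌋₊ ≤
      exp κ * exp (-(κ / R₀) * setDistEdges Λ₁ Λ₂) := by
    have hfl : setDistEdges Λ₁ Λ₂ / R₀ - 1 ≤ (⌊setDistEdges Λ₁ Λ₂ / R₀⌋₊ : ℝ) := by
      have := Nat.lt_floor_add_one (setDistEdges Λ₁ Λ₂ / R₀)
      linarith
    rw [← exp_add, ← Real.rpow_natCast, Real.rpow_def_of_pos hc'0]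
    refine exp_le_exp.2 ?_
    have hlog : Real.log c' = -κ := by rw [hκ, neg_neg]
    rw [hlog]
    have := mul_le_mul_of_nonneg_left hfl hκ0.le
    have e1 : -(κ / R₀) * setDistEdges Λ₁ Λ₂ = -(κ * (setDistEdges Λ₁ Λ₂ / R₀)) := by
      field_simp
    rw [e1]
    linarith
  have hsD := setDistEdges_nonneg Λ₁ Λ₂
  calc |cov[F₁, F₂; μ]|
      ≤ 2 * (2 * Real.sqrt N) ^ 2 * (∑ y ∈ Λ₂, (if y ∈ Λ₂ then 1 * (K₂ : ℝ) else 0)) *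
          ∑ y ∈ Λ₁, c' ^ ℓ y * (if y ∈ Λ₁ then 1 * (K₁ : ℝ) else 0) := key
    _ ≤ 2 * (2 * Real.sqrt N) ^ 2 * (n * K₂) * (n * (c' ^ ⌊setDistEdges Λ₁ Λ₂ / R₀⌋₊ * K₁)) := by
        refine mul_le_mul (mul_le_mul_of_nonneg_left hsum₂ (by positivity)) hsum₁
          (Finset.sum_nonneg fun y hy => ?_) (by positivity)
        rw [if_pos hy]; positivity
    _ ≤ 2 * (2 * Real.sqrt N) ^ 2 * (n * K₂) *
          (n * (exp κ * exp (-(κ / R₀) * setDistEdges Λ₁ Λ₂) * K₁)) := by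
        gcongr
    _ = 2 * (2 * Real.sqrt N) ^ 2 * (n : ℝ) ^ 2 * exp κ * exp (-(κ / R₀) * setDistEdges Λ₁ Λ₂) *
          ((K₁ : ℝ) * K₂) := by ring
    _ ≤ 2 * (2 * Real.sqrt N) ^ 2 * (n : ℝ) ^ 2 * exp κ * exp (-(κ / R₀) * setDistEdges Λ₁ Λ₂) *
          ((K₁ : ℝ) * K₂ + Real.sqrt (∫ U, F₁ U ^ 2 ∂μ) * Real.sqrt (∫ U, F₂ U ^ 2 ∂μ)) := by
        gcongr
        exact le_add_of_nonneg_right (by positivity)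

end Summit.Ventures.YMGap.RobustBall
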